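import Summits.BirchSwinnertonDyer.BirchSwinnertonDyer.Theorems.ManinLocalTwoThreeVeluDescentBlind
import Summits.BirchSwinnertonDyer.Rank1Residual.ManinAdditive.ShimuraKernelSplit
import Literature.NumberTheory.EllipticCurves.LatticeIndexTwoHalfPeriodProofs
import Mathlib.RingTheory.Polynomial.RationalRoot
import HarnessLib

/-!
# E-an-152 is NECESSARY: an undoubled Shimura cover of index `2` has a Kummer-BLIND kernel point
# (`C2 ⟹ ShimuraKernelBlindAtFour`; `GammaOneTransferAtFour ⟹ ShimuraKernelBlindAtFour`)

Summit `BirchSwinnertonDyer`, route `ManinLocalTwoThree` (cell bsd-f2-manin), deciding crux C2 `ManinOddAtFour`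
(stmt-BirchSwinnertonDyer-22967); lead p1 gen 14.  The an planner's Shimura-kernel split (`ShimuraKernel.lean`, MEMO-an §76)
reads the `2`-adic Γ₀/Γ₁ defect `δ = ord₂ c₀ − ord₂ c₁ ∈ {0, 1}` of a class at `4 ∣ N` off the Shimura index
`s = [Λ₀(f) : Λ₁(f)] ∈ {1, 2, 4}` and, at `s = 2`, off the Kummer-blindness of the kernel point `T_V = ℘(c₀w/2)`; the tree had
ONE direction — `δ = 1 ⟹ s = 4 ∨ (s = 2 ∧ T_V non-blind)` (`kernelToLedgerEdge_holds`, via the Vélu step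
`false_of_blind_halfPeriod_neronLattice`, p634444) — so that E-an-152 `ShimuraKernelBlindAtFour` (at `s = 2` the kernel point is
blind) was known SUFFICIENT (with E-an-152b) for the transfer E-an-151.  THIS FILE proves the CONVERSE direction:

* `kummerBlindAtTwo_of_halfPeriod_neronLattice_twice` — the lattice form of the converse Vélu step: if the Néron lattice of a
  globally minimal `W₁` is `2·(Λ_{E₀} + ℤz₀)` for a half-period `z₀` of `Λ_{E₀}` with `℘(z₀) = e + a₂/3`, then `(e, 0)` is
  Kummer-blind (Vélu's lattice `Λ_{E₀} + ℤz₀` has invariants `c₄(V), c₆(V)`, so `c₄(W₁) = c₄(V)/2⁴`, `c₆(W₁) = c₆(V)/2⁶`, and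
  `kummerBlindAtTwo_of_velu_descent` applies);
* `shimuraKernelBlindAt_of_natAbs_eq` — for the optimal `X₁(N)`/`X₀(N)` pair of a class at `4 ∣ N` (`W₀ = [0, a₂, 0, a₄, a₆]`):
  **`|c₀| = |c₁|` and `Λ₁(f) ≠ Λ₀(f)` force the kernel point `℘(c₀w/2)` (`w ∈ Λ₁(f) ∖ 2Λ₀(f)`) to be a RATIONAL, INTEGRAL,
  Kummer-BLIND `2`-torsion point** — E-an-152's conclusion, derived (half-lattice trichotomy on `Λ_{E₀} ⊆ ½Λ_{E₁}`: index `4` and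
  index `1` are excluded by `w` and by `Λ₁ ≠ Λ₀`; at index `2` the half-period is rational (p632972) and `Λ_{E₁} = 2(Λ_{E₀} + ℤz₀)`);
* `shimuraKernelBlindAtFour_of_transfer` — **E-an-151 `GammaOneTransferAtFour` ⟹ E-an-152** (through F-need
  `exists_optimal_gamma1ParametrizationData`), and `shimuraKernelBlindAtFour_of_body` / `…_of_maninOddAtFour` — **C2 ⟹ E-an-152**.

With `kernelToLedgerEdge_holds` this closes the loop: modulo F-need, on `a₁ = a₃ = 0` models
`E-an-151 ⟺ E-an-152 ∧ E-an-152b`, and the cell's search question at `p = 2` for the Γ₀/Γ₁ interface has a PROVED answer: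
`δ = [s = 4] + [s = 2 ∧ T_V non-blind]` (the iff is recorded in the sibling file `…ShimuraDefectLawAtTwo`).

HONEST FRAMING: structure theorems between the cell's nodes; E-an-151/152/152b stay OPEN; no Manin constant is decided; C2, Manin's
conjecture and BSD are not proved by this.  No definitions, no named facts, no sorry.
-/

set_option autoImplicit false
-- the summit-side namespace `Summit.BirchSwinnertonDyer.BirchSwinnertonDyer.…` is the tree's (summit = sub-problem)
set_option linter.dupNamespace false

noncomputable section

open Polynomial WeierstrassCurve Literature.NumberTheory.EllipticCurves Literature.NumberTheory.EllipticCurves.ModularForms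
open CongruenceSubgroup
open Summit.BirchSwinnertonDyer.Rank1Residual.ManinAdditive.ShimuraLedger
open Summit.BirchSwinnertonDyer.Rank1Residual.ManinAdditive.CuspidalKummer
open Summit.BirchSwinnertonDyer.Rank1Residual.ManinAdditive.ShimuraKernel

namespace Summit.BirchSwinnertonDyer.BirchSwinnertonDyer.Theorems.ManinLocalTwoThree

variable {W₁ W₀ : WeierstrassCurve ℚ} [W₁.IsElliptic] [W₁.IsGloballyMinimal] [W₀.IsElliptic]
  [W₀.IsGloballyMinimal] {N : ℕ} [NeZero N]

/-! ## §1 The converse Vélu step in lattice form -/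

omit [NeZero N] in
/-- **Converse Vélu step, lattice form.**  `W₀ : y² = x³ + a₂x² + a₄x + a₆` elliptic and globally minimal with Néron pair `L₀`, an
integral root `E` of the cubic, a half-period `z₀` of `Λ₀` with `℘(z₀) = E + a₂/3`, and a globally minimal `W₁` whose Néron lattice
is `Λ₁ = 2·(Λ₀ + ℤz₀)` (i.e. `y ∈ Λ₁ ⟺ y/2 ∈ Λ₀ ∪ (z₀ + Λ₀)`).  Then `(E, 0)` is Kummer-BLIND.  (Vélu: `Λ₀ + ℤz₀` is the Néron-type
lattice of `V = [0, −2A, 0, A² − 4B, 0]`, so `c₄(W₁) = c₄(V)/2⁴`, `c₆(W₁) = c₆(V)/2⁶`; then `kummerBlindAtTwo_of_velu_descent`.) -/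
theorem kummerBlindAtTwo_of_halfPeriod_neronLattice_twice (ha₁ : W₀.a₁ = 0) (ha₃ : W₀.a₃ = 0) {L₀ L₁ : PeriodPair}
    (hL₀ : IsNeronLatticeOf (W₀.baseChange ℂ) L₀) (hL₁ : IsNeronLatticeOf (W₁.baseChange ℂ) L₁)
    {A₂ A₄ E : ℤ} (hA₂ : (A₂ : ℚ) = W₀.a₂) (hA₄ : (A₄ : ℚ) = W₀.a₄)
    (he : (E : ℚ) ^ 3 + W₀.a₂ * (E : ℚ) ^ 2 + W₀.a₄ * E + W₀.a₆ = 0)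
    {z₀ : ℂ} (hz₀ : z₀ ∉ L₀.lattice) (h2 : 2 * z₀ ∈ L₀.lattice)
    (hx₀ : (L₀).weierstrassP z₀ = (((E : ℚ) + W₀.a₂ / 3 : ℚ) : ℂ))
    (hΛ : ∀ y : ℂ, y ∈ L₁.lattice ↔ (2⁻¹ * y ∈ L₀.lattice ∨ 2⁻¹ * y - z₀ ∈ L₀.lattice)) :
    KummerBlindAtTwo A₂ A₄ E := by
  -- the curve-side quantities (as in `false_of_blind_halfPeriod_neronLattice`)
  set e : ℚ := (E : ℚ) with he_def
  set q : ℚ := e + W₀.a₂ / 3 with hq_def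
  set B : ℚ := 3 * e ^ 2 + 2 * W₀.a₂ * e + W₀.a₄ with hB_def
  have hΔ := Δ_eq_of_isRoot W₀ ha₁ ha₃ he
  have hΔ0 : W₀.Δ ≠ 0 := by rw [← WeierstrassCurve.coe_Δ']; exact W₀.Δ'.ne_zero
  have hB0 : B ≠ 0 := by
    intro hB; apply hΔ0; rw [hΔ, ← hB_def, hB]; ring
  have hAB : (3 * q) ^ 2 - 4 * B ≠ 0 := by
    intro hAB; apply hΔ0
    have e3 : W₀.a₂ + 3 * e = 3 * q := by rw [hq_def]; ring
    rw [hΔ, ← hB_def, e3, hAB]; ring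
  -- Vélu's model and its Néron pair
  set V : WeierstrassCurve ℚ := ⟨0, -2 * (3 * q), 0, (3 * q) ^ 2 - 4 * B, 0⟩ with hV
  haveI hVell : V.IsElliptic := velu_isElliptic hB0 hAB
  haveI : (V.baseChange ℂ).IsElliptic := by rw [WeierstrassCurve.baseChange]; infer_instance
  obtain ⟨LV, hLV⟩ := exists_isNeronLatticeOf_holds (V.baseChange ℂ)
  have hc₄V : (V.baseChange ℂ).c₄ = (V.c₄ : ℂ) := by simp [WeierstrassCurve.baseChange, WeierstrassCurve.map_c₄]
  have hc₆V : (V.baseChange ℂ).c₆ = (V.c₆ : ℂ) := by simp [WeierstrassCurve.baseChange, WeierstrassCurve.map_c₆]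
  have hc₄W₀ : (W₀.baseChange ℂ).c₄ = (W₀.c₄ : ℂ) := by simp [WeierstrassCurve.baseChange, WeierstrassCurve.map_c₄]
  have hBc : ((B : ℚ) : ℂ) = 3 * (L₀).weierstrassP z₀ ^ 2 - L₀.g₂ / 4 := by
    rw [hx₀, hL₀.1, hc₄W₀]
    have h := velu_B_identity W₀ ha₁ ha₃ e
    rw [← hq_def, ← hB_def] at h
    have h' : (((3 * q ^ 2 - W₀.c₄ / 12 / 4 : ℚ)) : ℂ) = ((B : ℚ) : ℂ) := by rw [h]
    push_cast at h' ⊢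
    linear_combination -h'
  have hB0c : ((B : ℚ) : ℂ) ≠ 0 := by exact_mod_cast hB0
  have h₂V : LV.g₂ = 12 * (L₀).weierstrassP z₀ ^ 2 + 16 * ((B : ℚ) : ℂ) := by
    rw [hLV.1, hc₄V, hx₀]
    have h := velu_c₄_div (K := ℚ) q B
    have h' : (((⟨0, -2 * (3 * q), 0, (3 * q) ^ 2 - 4 * B, 0⟩ : WeierstrassCurve ℚ).c₄ / 12 : ℚ) : ℂ) =
        (((12 * q ^ 2 + 16 * B : ℚ)) : ℂ) := by rw [h]
    push_cast at h' ⊢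
    rw [hV]; exact h'
  have h₃V : LV.g₃ = -8 * (L₀).weierstrassP z₀ ^ 3 + 32 * ((B : ℚ) : ℂ) * (L₀).weierstrassP z₀ := by
    rw [hLV.2, hc₆V, hx₀]
    have h := velu_c₆_div (K := ℚ) q B
    have h' : (((⟨0, -2 * (3 * q), 0, (3 * q) ^ 2 - 4 * B, 0⟩ : WeierstrassCurve ℚ).c₆ / 216 : ℚ) : ℂ) =
        (((-8 * q ^ 3 + 32 * B * q : ℚ)) : ℂ) := by rw [h]
    push_cast at h' ⊢
    rw [hV]; exact h'
  -- Vélu's lattice is `Λ₀ + ℤz₀`, so `Λ₁ = 2·Λ_V`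
  obtain ⟨hleV, hz₀V, hidxV⟩ := L₀.lattice_eq_of_velu_invariants hz₀ h2 hBc hB0c LV h₂V h₃V
  set H : PeriodPair := LV.mulLeft 2 two_ne_zero with hH
  have hΛ' : L₁.lattice = H.lattice := by
    ext y
    rw [hH, PeriodPair.mem_mulLeft_lattice, hΛ y]
    constructor
    · rintro (h | h)
      · exact hleV h
      · have e' : (2 : ℂ)⁻¹ * y = (2⁻¹ * y - z₀) + z₀ := by ring
        rw [e']; exact add_mem (hleV h) hz₀V
    · exact hidxV _
  -- hence `c₄(W₁) = c₄(V)/2⁴`, `c₆(W₁) = c₆(V)/2⁶`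
  have hc₄W₁ : (W₁.baseChange ℂ).c₄ = (W₁.c₄ : ℂ) := by simp [WeierstrassCurve.baseChange, WeierstrassCurve.map_c₄]
  have hc₆W₁ : (W₁.baseChange ℂ).c₆ = (W₁.c₆ : ℂ) := by simp [WeierstrassCurve.baseChange, WeierstrassCurve.map_c₆]
  have h₄ : W₁.c₄ = ((2 : ℚ) ^ 4)⁻¹ * V.c₄ := by
    have h := PeriodPair.g₂_eq_of_lattice_eq hΛ'
    rw [hH, PeriodPair.g₂_mulLeft, hLV.1, hL₁.1, hc₄V, hc₄W₁] at h
    have h' : ((W₁.c₄ : ℚ) : ℂ) = ((((2 : ℚ) ^ 4)⁻¹ * V.c₄ : ℚ) : ℂ) := by push_cast; linear_combination (12 : ℂ) * h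
    exact_mod_cast h'
  have h₆ : W₁.c₆ = ((2 : ℚ) ^ 6)⁻¹ * V.c₆ := by
    have h := PeriodPair.g₃_eq_of_lattice_eq hΛ'
    rw [hH, PeriodPair.g₃_mulLeft, hLV.2, hL₁.2, hc₆V, hc₆W₁] at h
    have h' : ((W₁.c₆ : ℚ) : ℂ) = ((((2 : ℚ) ^ 6)⁻¹ * V.c₆ : ℚ) : ℂ) := by push_cast; linear_combination (216 : ℂ) * h
    exact_mod_cast h'
  exact kummerBlindAtTwo_of_velu_descent W₀ ha₁ ha₃ hA₂ hA₄ he W₁ h₄ h₆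

/-! ## §2 The undoubled index-`2` Shimura cover has a blind kernel point -/

/-- **`|c₀| = |c₁|` and `Λ₁(f) ≠ Λ₀(f)` force a BLIND kernel point.**  For the optimal `X₁(N)`-datum `D₁` and a lattice-optimal
`X₀(N)`-datum `D₀` of two isogenous globally minimal curves (`W₀ = [0, a₂, 0, a₄, a₆]`), `4 ∣ N`, with UNDOUBLED constants
`|c₀| = |c₁|` and a non-trivial Shimura kernel `Λ₁(f) ≠ Λ₀(f)`: for every `w ∈ Λ₁(f) ∖ 2Λ₀(f)` the half-period `c₀w/2` of `Λ_{E₀}`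
has `℘`-value `E + a₂/3` for an INTEGRAL root `E` of the cubic, and `(E, 0)` is Kummer-BLIND — exactly the conclusion of E-an-152
`ShimuraKernelBlindAtFour` at `(W₀, D₀, w)`.  (Half-lattice trichotomy on `Λ_{E₀} ⊆ ½Λ_{E₁}`; `w` excludes `½Λ_{E₁} ⊆ Λ_{E₀}`,
`Λ₁ ≠ Λ₀` excludes `½Λ_{E₀} ⊆ ½Λ_{E₁}`; at index `2` the half-period is rational (p632972), integral (rational root theorem), and
`Λ_{E₁} = 2(Λ_{E₀} + ℤ·c₀w/2)`, so §1 applies.) -/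
theorem shimuraKernelBlindAt_of_natAbs_eq (D₁ : Gamma1ParametrizationData W₁ N) (D₀ : ModularParametrizationData W₀ N)
    (hiso : IsIsogenous W₁ W₀) (h₁ : D₁.IsOptimal)
    (h₀ : ∀ z ∈ D₀.L.lattice, ∃ w ∈ periodLattice D₀.f, z = D₀.c * w) (h4 : 2 ^ 2 ∣ N)
    (ha₁ : W₀.a₁ = 0) (ha₃ : W₀.a₃ = 0) (heq : D₀.maninConstant.natAbs = D₁.maninConstant.natAbs)
    (hΛne : periodLatticeGamma1 D₀.f ≠ periodLattice D₀.f)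
    {w : ℂ} (hw : w ∈ periodLatticeGamma1 D₀.f) (hw2 : ∀ v ∈ periodLattice D₀.f, w ≠ 2 * v) :
    ∃ A₂ A₄ E : ℤ, (A₂ : ℚ) = W₀.a₂ ∧ (A₄ : ℚ) = W₀.a₄ ∧
      (E : ℚ) ^ 3 + W₀.a₂ * (E : ℚ) ^ 2 + W₀.a₄ * E + W₀.a₆ = 0 ∧
      D₀.L.weierstrassP ((D₀.c : ℂ) * w / 2) = (((E : ℚ) + W₀.a₂ / 3 : ℚ) : ℂ) ∧ KummerBlindAtTwo A₂ A₄ E := by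
  have hf : D₁.f = D₀.f := D₁.f_eq_of_isIsogenous D₀ hiso
  have hc₁ : (D₁.c : ℂ) ≠ 0 := by exact_mod_cast D₁.maninConstant_ne_zero
  have hc₀ : (D₀.c : ℂ) ≠ 0 := by exact_mod_cast D₀.maninConstant_ne_zero_holds
  -- `c₀ = ε c₁`
  obtain ⟨ε, hε, hcc⟩ : ∃ ε : ℂ, (ε = 1 ∨ ε = -1) ∧ (D₀.c : ℂ) = ε * D₁.c := by
    rcases Int.natAbs_eq_natAbs_iff.mp heq with h' | h'
    · exact ⟨1, Or.inl rfl, by rw [one_mul]; exact_mod_cast h'⟩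
    · exact ⟨-1, Or.inr rfl, by rw [neg_one_mul]; exact_mod_cast h'⟩
  have hε2 : ε * ε = 1 := by rcases hε with rfl | rfl <;> norm_num
  have hεmem : ∀ (S : AddSubgroup ℂ) (y : ℂ), y ∈ S → ε * y ∈ S := by
    intro S y hy; rcases hε with rfl | rfl
    · rwa [one_mul]
    · rw [neg_one_mul]; exact neg_mem hy
  -- Ling–Oesterlé at the traceless prime `2`: `2Λ₀ ⊆ Λ₁`
  have h2Λ : ∀ v ∈ periodLattice D₀.f, (2 : ℂ) * v ∈ periodLatticeGamma1 D₀.f := fun v hv ↦ by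
    have h := pMulLatticeLeGamma1OfTracelessPrime_holds N D₀.f D₀.isNewformOf.1 2 Nat.prime_two
      ((dvd_pow_self 2 two_ne_zero).trans h4) (D₀.isNewformOf.1.cuspCoeff_eq_zero_of_sq_dvd Nat.prime_two h4) v hv
    exact_mod_cast h
  -- `H = ½Λ_{E₁}`: `Λ_{E₀} ⊆ H`, `2H ⊆ Λ_{E₀}`
  set H : PeriodPair := D₁.L.mulLeft ((2 : ℂ)⁻¹) (inv_ne_zero two_ne_zero) with hH
  have hHmem : ∀ z, z ∈ H.lattice ↔ 2 * z ∈ D₁.L.lattice := fun z ↦ by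
    rw [hH, PeriodPair.mem_mulLeft_lattice, inv_inv]
  have hle : D₀.L.lattice ≤ H.lattice := by
    intro z hz
    obtain ⟨v, hv, rfl⟩ := h₀ z hz
    rw [hHmem]
    have e : 2 * ((D₀.c : ℂ) * v) = (D₁.c : ℂ) * (ε * (2 * v)) := by rw [hcc]; ring
    rw [e]
    exact D₁.smul_periodLatticeGamma1_le _ (hεmem _ _ (by rw [hf]; exact h2Λ v hv))
  have htwo : ∀ y ∈ H.lattice, 2 * y ∈ D₀.L.lattice := by
    intro y hy
    rw [hHmem] at hy
    obtain ⟨w₁, hw₁, hw₁'⟩ := h₁ _ hy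
    have hw₀ : ε * w₁ ∈ periodLattice D₀.f := hεmem _ _ (hf ▸ periodLatticeGamma1_le_periodLattice D₁.f hw₁)
    have e : 2 * y = (D₀.c : ℂ) * (ε * w₁) := by
      rw [hw₁', hcc]; linear_combination -((D₁.c : ℂ) * w₁) * hε2
    rw [e]; exact D₀.smul_periodLattice_le _ hw₀
  -- the kernel point `z₀ = c₀ w / 2`
  set z₀ : ℂ := (D₀.c : ℂ) * w / 2 with hz₀def
  have hz₀H : z₀ ∈ H.lattice := by
    rw [hHmem, show 2 * z₀ = (D₁.c : ℂ) * (ε * w) by rw [hz₀def, hcc]; ring]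
    exact D₁.smul_periodLatticeGamma1_le _ (by rw [hf]; exact hεmem _ _ hw)
  have hz₀ : z₀ ∉ D₀.L.lattice := by
    intro h
    obtain ⟨v, hv, hv'⟩ := h₀ _ h
    refine hw2 v hv (mul_left_cancel₀ hc₀ ?_)
    linear_combination (2 : ℂ) * hv'
  have h2z₀ : 2 * z₀ ∈ D₀.L.lattice := htwo z₀ hz₀H
  rcases halfLattice_trichotomy D₀.L H hle htwo with hcase | hcase | hcase
  · -- `½Λ_{E₁} ⊆ Λ_{E₀}` (index 4): then `z₀ ∈ Λ_{E₀}` — excluded by `w ∉ 2Λ₀`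
    exact absurd (hcase _ hz₀H) hz₀
  · -- `½Λ_{E₀} ⊆ ½Λ_{E₁}`: `Λ₀ ⊆ Λ₁` — excluded by `Λ₁ ≠ Λ₀`
    exfalso
    refine hΛne (le_antisymm (periodLatticeGamma1_le_periodLattice D₀.f) fun v hv ↦ ?_)
    have h2h : 2 * ((D₀.c : ℂ) * v * 2⁻¹) ∈ D₀.L.lattice := by
      rw [show 2 * ((D₀.c : ℂ) * v * 2⁻¹) = (D₀.c : ℂ) * v by ring]; exact D₀.smul_periodLattice_le v hv
    have hH' := hcase _ h2h
    rw [hHmem, show 2 * ((D₀.c : ℂ) * v * 2⁻¹) = (D₀.c : ℂ) * v by ring] at hH'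
    obtain ⟨w₁, hw₁, hw₁'⟩ := h₁ _ hH'
    have hv' : v = ε * w₁ := by
      have h : (D₁.c : ℂ) * v = (D₁.c : ℂ) * (ε * w₁) := by
        rw [hcc] at hw₁'
        linear_combination ε * hw₁' - ((D₁.c : ℂ) * v) * hε2
      exact mul_left_cancel₀ hc₁ h
    rw [hv', ← hf]; exact hεmem _ _ hw₁
  · -- index 2: `H = Λ_{E₀} + ℤz₀`
    obtain ⟨z₁, hz₁', hz₁, hidx₁⟩ := hcase
    have hzz : z₀ - z₁ ∈ D₀.L.lattice := (hidx₁ z₀ hz₀H).resolve_left hz₀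
    have hidx : ∀ y ∈ H.lattice, y ∈ D₀.L.lattice ∨ y - z₀ ∈ D₀.L.lattice := by
      intro y hy
      rcases hidx₁ y hy with h | h
      · exact Or.inl h
      · right
        have e' : y - z₀ = (y - z₁) - (z₀ - z₁) := by ring
        rw [e']; exact sub_mem h hzz
    -- `℘(z₀)` is rational …
    have hc₄W₁ : (W₁.baseChange ℂ).c₄ = (W₁.c₄ : ℂ) := by simp [WeierstrassCurve.baseChange, WeierstrassCurve.map_c₄]
    have hc₆W₁ : (W₁.baseChange ℂ).c₆ = (W₁.c₆ : ℂ) := by simp [WeierstrassCurve.baseChange, WeierstrassCurve.map_c₆]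
    have hc₄W₀ : (W₀.baseChange ℂ).c₄ = (W₀.c₄ : ℂ) := by simp [WeierstrassCurve.baseChange, WeierstrassCurve.map_c₄]
    have hc₆W₀ : (W₀.baseChange ℂ).c₆ = (W₀.c₆ : ℂ) := by simp [WeierstrassCurve.baseChange, WeierstrassCurve.map_c₆]
    have hg₂H : ∃ r : ℚ, (r : ℂ) = H.g₂ :=
      ⟨2 ^ 4 * (W₁.c₄ / 12), by rw [hH, PeriodPair.g₂_mulLeft, D₁.isNeronLattice.1, hc₄W₁]; push_cast; ring⟩
    have hg₃H : ∃ r : ℚ, (r : ℂ) = H.g₃ :=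
      ⟨2 ^ 6 * (W₁.c₆ / 216), by rw [hH, PeriodPair.g₃_mulLeft, D₁.isNeronLattice.2, hc₆W₁]; push_cast; ring⟩
    obtain ⟨x, hx⟩ := D₀.L.exists_ratCast_eq_weierstrassP_of_index_two H hle
      ⟨W₀.c₄ / 12, by rw [D₀.isNeronLattice.1, hc₄W₀]; push_cast; ring⟩
      ⟨W₀.c₆ / 216, by rw [D₀.isNeronLattice.2, hc₆W₀]; push_cast; ring⟩ hg₂H hg₃H hz₀H hz₀ hidx
    -- … and a root of the cubic …
    have hcubic : 4 * (D₀.L).weierstrassP z₀ ^ 3 - D₀.L.g₂ * (D₀.L).weierstrassP z₀ - D₀.L.g₃ = 0 := by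
      rw [← D₀.L.derivWeierstrassP_sq z₀ hz₀, D₀.L.derivWeierstrassP_eq_zero_of_two_mul_mem h2z₀]; ring
    have heC := isRoot_cubic_of_weierstrassP_sub W₀ ha₁ ha₃ D₀.isNeronLattice hcubic
    rw [← hx] at heC
    have heQ : (x - W₀.a₂ / 3) ^ 3 + W₀.a₂ * (x - W₀.a₂ / 3) ^ 2 + W₀.a₄ * (x - W₀.a₂ / 3) + W₀.a₆ = 0 := by
      have h : (((x - W₀.a₂ / 3) ^ 3 + W₀.a₂ * (x - W₀.a₂ / 3) ^ 2 + W₀.a₄ * (x - W₀.a₂ / 3) + W₀.a₆ : ℚ) : ℂ) = 0 := by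
        push_cast; exact heC
      exact_mod_cast h
    -- … hence an INTEGER (rational root theorem on the integral model of `W₀`)
    set M₀ : WeierstrassCurve ℤ := integralModelInt W₀ with hM₀
    have hWM₀ : M₀.map (Int.castRingHom ℚ) = W₀ := map_integralModelInt W₀
    have hA₂ : (M₀.a₂ : ℚ) = W₀.a₂ := by rw [← hWM₀, map_a₂, eq_intCast]
    have hA₄ : (M₀.a₄ : ℚ) = W₀.a₄ := by rw [← hWM₀, map_a₄, eq_intCast]
    have hA₆ : (M₀.a₆ : ℚ) = W₀.a₆ := by rw [← hWM₀, map_a₆, eq_intCast]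
    obtain ⟨E, hE⟩ : ∃ E : ℤ, (E : ℚ) = x - W₀.a₂ / 3 := by
      set P : Cubic ℤ := ⟨1, M₀.a₂, M₀.a₄, M₀.a₆⟩ with hP
      have hmonic : P.toPoly.Monic := Cubic.monic_of_a_eq_one rfl
      have haeval : aeval (x - W₀.a₂ / 3) P.toPoly = 0 := by
        simp only [hP, Cubic.toPoly, map_add, map_mul, map_pow, aeval_X, map_one, one_mul, eq_intCast, map_intCast]
        rw [hA₂, hA₄, hA₆]; linear_combination heQ
      obtain ⟨e₀, he₀, -⟩ := exists_integer_of_is_root_of_monic hmonic haeval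
      exact ⟨e₀, by rw [he₀, eq_intCast]⟩
    have he : (E : ℚ) ^ 3 + W₀.a₂ * (E : ℚ) ^ 2 + W₀.a₄ * E + W₀.a₆ = 0 := by rw [hE]; exact heQ
    have hx₀ : (D₀.L).weierstrassP z₀ = (((E : ℚ) + W₀.a₂ / 3 : ℚ) : ℂ) := by
      rw [← hx]; congr 1; rw [hE]; ring
    -- `Λ_{E₁} = 2(Λ_{E₀} + ℤz₀)`
    have hΛ : ∀ y : ℂ, y ∈ D₁.L.lattice ↔ (2⁻¹ * y ∈ D₀.L.lattice ∨ 2⁻¹ * y - z₀ ∈ D₀.L.lattice) := by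
      intro y
      have hyH : y ∈ D₁.L.lattice ↔ 2⁻¹ * y ∈ H.lattice := by
        rw [hHmem, show (2 : ℂ) * (2⁻¹ * y) = y by ring]
      rw [hyH]
      constructor
      · exact hidx _
      · rintro (h | h)
        · exact hle h
        · have e' : (2 : ℂ)⁻¹ * y = (2⁻¹ * y - z₀) + z₀ := by ring
          rw [e']; exact add_mem (hle h) hz₀H
    exact ⟨M₀.a₂, M₀.a₄, E, hA₂, hA₄, he, hx₀,
      kummerBlindAtTwo_of_halfPeriod_neronLattice_twice ha₁ ha₃ D₀.isNeronLattice D₁.isNeronLattice hA₂ hA₄ he hz₀ h2z₀ hx₀ hΛ⟩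

/-! ## §3 E-an-152 is necessary for the transfer, hence for C2 -/

omit [W₁.IsElliptic] [W₁.IsGloballyMinimal] [W₀.IsElliptic] [W₀.IsGloballyMinimal] [NeZero N] in
/-- **E-an-151 ⟹ E-an-152** (through F-need `exists_optimal_gamma1ParametrizationData`, which supplies the Stevens datum of the
class): if the optimal pair of every class at `4 ∣ N` has `|c₀| = |c₁|`, then at Shimura index `2` the kernel point is Kummer-blind. -/
theorem shimuraKernelBlindAtFour_of_transfer (hex : exists_optimal_gamma1ParametrizationData) (h151 : GammaOneTransferAtFour) :
    ShimuraKernelBlindAtFour := by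
  intro W₀ _ _ N _ D₀ h₀ h4 ha₁ ha₃ hΛne w hw hw2
  obtain ⟨W₁, _, _, D₁, hiso, h₁⟩ := hex W₀ D₀ h₀
  exact shimuraKernelBlindAt_of_natAbs_eq D₁ D₀ hiso h₁ h₀ h4 ha₁ ha₃ (h151 W₁ W₀ D₁ D₀ hiso h₁ h₀ h4) hΛne hw hw2

omit [W₁.IsElliptic] [W₁.IsGloballyMinimal] [W₀.IsElliptic] [W₀.IsGloballyMinimal] [NeZero N] in
/-- **C2-body ⟹ E-an-152** (through F-need): the Kummer-blindness of the index-`2` kernel point is a CONSEQUENCE of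
`ManinOddAtFour` (`gammaOneTransferAtFour_of_body` + `shimuraKernelBlindAtFour_of_transfer`).  So, modulo F-need and on `a₁ = a₃ = 0`
models, E-an-152 ∧ E-an-152b is EQUIVALENT to E-an-151 (sufficiency: `transfer_of_kernel_rows'`). -/
theorem shimuraKernelBlindAtFour_of_body (hex : exists_optimal_gamma1ParametrizationData) (h : ManinOddAtFourBody) :
    ShimuraKernelBlindAtFour :=
  shimuraKernelBlindAtFour_of_transfer hex (gammaOneTransferAtFour_of_body h)

omit [W₁.IsElliptic] [W₁.IsGloballyMinimal] [W₀.IsElliptic] [W₀.IsGloballyMinimal] [NeZero N] in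
/-- **The route declaration ⟹ E-an-152**: C2 `ManinOddAtFour` (GIVEN its three printed semistable facts and modularity, as in the route
file) and F-need imply `ShimuraKernelBlindAtFour`.  CONDITIONAL edge; C2 is OPEN; BSD is not proved by this. -/
theorem shimuraKernelBlindAtFour_of_maninOddAtFour
    (hMaz : mazur_not_dvd_maninConstant_of_odd) (hAU : abbesUllmo_not_dvd_maninConstant_of_not_dvd_level)
    (hCes : cesnavicius_not_two_dvd_maninConstant_of_two_dvd_level) (hEx : exists_isNewformOf)
    (hex : exists_optimal_gamma1ParametrizationData)
    (hC2 : Summit.BirchSwinnertonDyer.BirchSwinnertonDyer.Theses.ManinLocalTwoThree.ManinOddAtFour) :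
    ShimuraKernelBlindAtFour :=
  shimuraKernelBlindAtFour_of_body hex (fun W _ _ _ _ D hL h4 ↦ hC2 hMaz hAU hCes hEx W D hL h4)

end Summit.BirchSwinnertonDyer.BirchSwinnertonDyer.Theorems.ManinLocalTwoThree

end
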